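import Literature.NumberTheory.EllipticCurves.ShaRestrictionJZeroInvariants
import Summits.BirchSwinnertonDyer.BirchSwinnertonDyer.Theorems.SylvesterTwoHeegnerIndexShaConjugation
import HarnessLib

/-!
# Route `SylvesterTwoHeegnerIndex` (rung K7t), crux `UpperOffV0HSYPlus` (item 19804): the ARITHMETIC
# WRAPPER, brick (K-ty/ORDER FORM) — LEMMA K0's order form:
# `#Ш(E_K/K)[2^∞] = (#Ш(E/ℚ)[2^∞])²` for a `j = 0` short model and `K = ℚ(ω)`

Cell `bsd-cm` (`run/shared/lean/pub/bsd-cm/`), row (M1)(K-ty) (seat `bsd-cm-k-ty1`, SPEC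
`HOME/bsd-cm-k-ty1/SPEC-K-TY.md`); DRAFTED by the literature-prover seat and handed to a prover seat
for filing (`--supports stmt-BirchSwinnertonDyer-19804 --as helper`; Theorems/ is prover-only,
D-0016). PARTITION (D-0054): CornerF at `p = 2` (B14/O12) × 𝒞_HSY × `p = 2` — types-the-object-of.
Joins the landed bricks: the EXACT DESCENT `res : Ш(E/ℚ) ⥲ Ш(E_K/K)^{τ}`
(`Literature.NumberTheory.EllipticCurves.JZero.shaRestriction_injective_of_isPrimitiveRoot`,
`conjH1Points_shaRestriction` — file `Literature/…/ShaRestrictionJZeroDescent.lean`, p608170;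
`JZero.exists_shaRestriction_eq_of_conjH1Points_eq` — file `Literature/…/ShaRestrictionJZeroInvariants.lean`,
p611553, via the CM corestriction of `ShaRestrictionJZeroCorestriction.lean`, p611060, and the exact
local descent of `ShaRestrictionJZeroLocalDescent.lean`, p610274), and the SQUARE LAW of LEMMA D on the
genuine `Ш` (`SylvesterTwoShaConjugation.card_sha_two_primary_eq_card_invariants_sq`, p604055, with
(WRAP-𝒪) p603310). Output: LEMMA K0's order form «`#Ш(X/K)[2^∞] = #Ш(X/ℚ)[2^∞]²`» (memo two
v2.21 §57.1) as an EQUALITY of `Nat.card`s (`natCard_primaryComponent_sha_baseChange_eq_sq`; both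
sides read `0` if infinite), its `ord₂` form `ord₂ #Ш(X_K/K)[2^∞] = 2·s_X`
(`padicValNat_card_primaryComponent_sha_baseChange`), the earlier UPPER-half divisibility
(`natCard_primaryComponent_sha_sq_dvd`), and the stub-currency / binder forms. A coupled `𝒪₂`-length
statement over `K` (THEOREM K3's native output, §64) thereby converts EXACTLY into
`s_B + s_A = ord₂(#Ш(B)[2^∞]·#Ш(A)[2^∞])`. Closes no cell and no item; BSD is not claimed.
Everything is PROVED: no definition, no instance, no notation, no named fact, no `sorry`.

## References
Gross, LMS LNS 153 (1991), §5 (5.1) [GrossLMS1991]; Silverman, *AEC* (2009), Thm. III.10.1,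
Cor. III.10.2 [SilvermanAEC2009]; Milne, *ADT* (2006), I.§6, Lemma I.7.1 [MilneADT2006]; cell: memo
two v2.21 §57.1 (LEMMA K0), SPEC-K-TY (I1)–(I4), planner D347/D351 (M1)(K-ty).
-/

set_option autoImplicit false
set_option linter.dupNamespace false

noncomputable section

open scoped Classical

open WeierstrassCurve Literature.NumberTheory.EllipticCurves
  Literature.NumberTheory.GaloisRepresentations NumberField

namespace Summit.BirchSwinnertonDyer.BirchSwinnertonDyer.Theorems.SylvesterTwoShaDescentOrderForm

variable (W : WeierstrassCurve ℚ) [W.IsElliptic] (K : Type) [Field K] [NumberField K]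
variable {σ : K ≃ₐ[ℚ] K} {τ : AlgebraicClosure K ≃+* AlgebraicClosure K}

omit [W.IsElliptic] in
/-- A `j = 0` short model stays one after base change: `W_K = ⟨0, 0, 0, 0, a₆⟩` (the `hW` input of
`SylvesterTwoShaConjugation.exists_lemmaD_data`). [folklore] -/
theorem baseChange_eq_of_a_eq_zero (ha₁ : W.a₁ = 0) (ha₂ : W.a₂ = 0) (ha₃ : W.a₃ = 0)
    (ha₄ : W.a₄ = 0) : W.baseChange K = ⟨0, 0, 0, 0, algebraMap ℚ K W.a₆⟩ := by
  ext <;> simp [WeierstrassCurve.baseChange, ha₁, ha₂, ha₃, ha₄]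

/-- **LEMMA K0, ORDER FORM, UPPER HALF** (memo two §57.1 «`#Ш(X/K)[2^∞] = #Ш(X/ℚ)[2^∞]²`», the
divisibility `≥`). `E = W/ℚ` an elliptic `j = 0` short model (all of `a₁, …, a₄` zero), `K` a
totally complex quadratic number field with a primitive cube root of unity `ζ` (`K ≅ ℚ(ω)`),
`σ ∈ Aut(K/ℚ)` an involution with `σ ζ = ζ²`, `τ` a lift. Then
`(#Ш(E/ℚ)[2^∞])² ∣ #Ш(E_K/K)[2^∞]` (as `Nat.card`; vacuous — divides `0` — if the right side is
infinite). Proof: `Ш(E/ℚ)[2^∞] ↪ M^{τ_*}`, `M = Ш(E_K/K)[2^∞]` (injectivity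
`JZero.shaRestriction_injective_of_isPrimitiveRoot` + invariance `conjH1Points_shaRestriction`), and
`#M = (#M^{τ_*})²` is LEMMA D's SQUARE LAW on the genuine `Ш`
(`SylvesterTwoShaConjugation.card_sha_two_primary_eq_card_invariants_sq`). [cite: GrossLMS1991, §5 (5.1)]
[cite: SilvermanAEC2009, Thm. III.10.1 and Cor. III.10.2] [cite: MilneADT2006, Ch. I §6 p. 75] -/
theorem natCard_primaryComponent_sha_sq_dvd (hK : ∀ v : InfinitePlace K, v.IsComplex)
    (hτ : IsLiftOfAut σ τ) (hσ2 : σ * σ = 1) (ha₁ : W.a₁ = 0) (ha₂ : W.a₂ = 0) (ha₃ : W.a₃ = 0)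
    (ha₄ : W.a₄ = 0) (h2 : Module.finrank ℚ K = 2) {ζ : K} (hζ : IsPrimitiveRoot ζ 3)
    (hσζ : σ ζ = ζ ^ 2) :
    Nat.card (AddCommGroup.primaryComponent W.sha 2) ^ 2 ∣
      Nat.card (AddCommGroup.primaryComponent (W.baseChange K).sha 2) := by
  obtain ⟨s, hs, -, hcard⟩ := SylvesterTwoShaConjugation.card_sha_two_primary_eq_card_invariants_sq
    W hK hτ hσ2 (baseChange_eq_of_a_eq_zero W K ha₁ ha₂ ha₃ ha₄) hζ hσζ
  rw [hcard]
  apply pow_dvd_pow_of_dvd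
  -- the injection `Ш(E/ℚ)[2^∞] ↪ ker (s - id)`
  have hinj := JZero.shaRestriction_injective_of_isPrimitiveRoot W K ha₁ ha₂ ha₃ ha₄ h2 hζ hσζ
  let r : AddCommGroup.primaryComponent W.sha 2 →+
      AddCommGroup.primaryComponent (W.baseChange K).sha 2 :=
    ((shaRestriction W K).comp (AddCommGroup.primaryComponent W.sha 2).subtype).codRestrict _
      fun c ↦ map_mem_primaryComponent (shaRestriction W K) c.2
  have hr : ∀ c, ((r c : AddCommGroup.primaryComponent (W.baseChange K).sha 2) :
      (W.baseChange K).sha) = shaRestriction W K c := fun _ ↦ rfl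
  have hker : ∀ c, r c ∈ (s - AddMonoidHom.id _).ker := by
    intro c
    rw [AddMonoidHom.mem_ker, AddMonoidHom.sub_apply, AddMonoidHom.id_apply, sub_eq_zero]
    apply Subtype.ext
    apply Subtype.ext
    rw [hs, hr, conjH1Points_shaRestriction]
  let r' : AddCommGroup.primaryComponent W.sha 2 →+ (s - AddMonoidHom.id _).ker :=
    r.codRestrict _ hker
  refine AddSubgroup.card_dvd_of_injective r' fun c c' h ↦ ?_
  have h' : r c = r c' := congrArg Subtype.val h
  have h'' : shaRestriction W K c = shaRestriction W K c' := by
    rw [← hr, ← hr, h']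
  exact Subtype.ext (hinj h'')

/-- **The same in the currency of the VARIANT K stubs** (arbitrary `ℚ`-models): for `X` with
`C • X = ⟨0, 0, 0, 0, b⟩` (`b = −432 p²` resp. `−432·9p⁴`: `HuShuYin2019.cubeSumCurve p`, `(3p²)`, by
`rfl`), `K`, `ζ`, `σ`, `τ` as above: `(#Ш(X/ℚ)[2^∞])² ∣ #Ш(⟨0,0,0,0,b⟩_K / K)[2^∞]` — so
`2 · ord₂ #Ш(X/ℚ)[2^∞] ≤ ord₂ #Ш(⟨0,0,0,0,b⟩_K/K)[2^∞]` whenever the latter group is finite: the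
form in which a coupled `𝒪₂`-length bound over `K = ℚ(ω)` (THEOREM K3 / K3*, memo two §64–§67) bounds
`s_B + s_A` from ABOVE in `stub_tailFour/Seven`. MODEL TRANSPORT by
`natCard_primaryComponent_sha_eq_of_variableChange`. [cite: GrossLMS1991, §5 (5.1)]
[cite: MilneADT2006, Ch. I Lemma 7.1(b), p. 96] -/
theorem natCard_primaryComponent_sha_sq_dvd_of_variableChange {X : WeierstrassCurve ℚ}
    [X.IsElliptic] {b : ℚ} {C : VariableChange ℚ} (hC : C • X = ⟨0, 0, 0, 0, b⟩)
    (hK : ∀ v : InfinitePlace K, v.IsComplex) (hτ : IsLiftOfAut σ τ) (hσ2 : σ * σ = 1)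
    (h2 : Module.finrank ℚ K = 2) {ζ : K} (hζ : IsPrimitiveRoot ζ 3) (hσζ : σ ζ = ζ ^ 2) :
    Nat.card (AddCommGroup.primaryComponent X.sha 2) ^ 2 ∣
      Nat.card (AddCommGroup.primaryComponent
        ((⟨0, 0, 0, 0, b⟩ : WeierstrassCurve ℚ).baseChange K).sha 2) := by
  haveI : (⟨0, 0, 0, 0, b⟩ : WeierstrassCurve ℚ).IsElliptic := hC ▸ inferInstance
  rw [natCard_primaryComponent_sha_eq_of_variableChange hC 2]
  exact natCard_primaryComponent_sha_sq_dvd ⟨0, 0, 0, 0, b⟩ K hK hτ hσ2 rfl rfl rfl rfl h2 hζ hσζ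

/-- **LEMMA K0, ORDER FORM, UPPER HALF — binder form** (the convention
`(K : Type) [NumberField K] (ω : K), ω² + ω + 1 = 0 → finrank ℚ K = 2` of
`HuShuYin2019.shaAnPair_mul_height_eq_two_zpow_mul_height` and of `PublishedFactsTwoPlus`): for
`X` with `C • X = ⟨0, 0, 0, 0, b⟩` (`= cubeSumCurve p` resp. `cubeSumCurve (3p²)` by `rfl`):
`(#Ш(X/ℚ)[2^∞])² ∣ #Ш(⟨0,0,0,0,b⟩_K/K)[2^∞]`; all of `ζ`, `σ`, `τ`, total complexity are
discharged by `JZero.exists_aut_apply_eq_sq` and `isLiftOfAut_liftAut`.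
[cite: GrossLMS1991, §5 (5.1)] [cite: MilneADT2006, Ch. I Lemma 7.1(b), p. 96] -/
theorem natCard_primaryComponent_sha_sq_dvd_of_variableChange_of_omega {X : WeierstrassCurve ℚ}
    [X.IsElliptic] {b : ℚ} {C : VariableChange ℚ} (hC : C • X = ⟨0, 0, 0, 0, b⟩) {ω : K}
    (hω : ω ^ 2 + ω + 1 = 0) (h2 : Module.finrank ℚ K = 2) :
    Nat.card (AddCommGroup.primaryComponent X.sha 2) ^ 2 ∣
      Nat.card (AddCommGroup.primaryComponent
        ((⟨0, 0, 0, 0, b⟩ : WeierstrassCurve ℚ).baseChange K).sha 2) := by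
  obtain ⟨hζ, hK, σ, hσζ, hσ2⟩ := JZero.exists_aut_apply_eq_sq K hω h2
  exact natCard_primaryComponent_sha_sq_dvd_of_variableChange K hC hK (isLiftOfAut_liftAut σ) hσ2
    h2 hζ hσζ

/-! ## LEMMA K0, ORDER FORM — the EQUALITY -/

/-- **LEMMA K0, ORDER FORM** (memo two §57.1): `#Ш(E_K/K)[2^∞] = (#Ш(E/ℚ)[2^∞])²` for `E = W/ℚ` an
elliptic `j = 0` short model, `K` a totally complex quadratic number field with a primitive cube root
of unity `ζ`, `σ ∈ Aut(K/ℚ)` an involution with `σ ζ = ζ²` (as `Nat.card`s: both sides are `0` when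
`Ш(E_K/K)[2^∞]` is infinite, since `res` is then an injection of an infinite group… precisely: the
equality is of cardinals-as-`Nat.card`, from a BIJECTION `Ш(E/ℚ)[2^∞] ≃ M^{τ_*}`, `M = Ш(E_K/K)[2^∞]`,
and the square law `#M = (#M^{τ_*})²`). Bijection: injectivity
`JZero.shaRestriction_injective_of_isPrimitiveRoot`, invariance `conjH1Points_shaRestriction`,
surjectivity onto the invariants `JZero.exists_shaRestriction_eq_of_conjH1Points_eq` (for the chosen
lift `τ = liftAut σ`); square law `SylvesterTwoShaConjugation.card_sha_two_primary_eq_card_invariants_sq`.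
[cite: GrossLMS1991, §5 (5.1)] [cite: SilvermanAEC2009, Thm. III.10.1 and Cor. III.10.2]
[cite: MilneADT2006, Ch. I §6 p. 75] -/
theorem natCard_primaryComponent_sha_baseChange_eq_sq (hK : ∀ v : InfinitePlace K, v.IsComplex)
    (hσ2 : σ * σ = 1) (ha₁ : W.a₁ = 0) (ha₂ : W.a₂ = 0) (ha₃ : W.a₃ = 0) (ha₄ : W.a₄ = 0)
    (h2 : Module.finrank ℚ K = 2) {ζ : K} (hζ : IsPrimitiveRoot ζ 3) (hσζ : σ ζ = ζ ^ 2) :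
    Nat.card (AddCommGroup.primaryComponent (W.baseChange K).sha 2) =
      Nat.card (AddCommGroup.primaryComponent W.sha 2) ^ 2 := by
  obtain ⟨s, hs, -, hcard⟩ := SylvesterTwoShaConjugation.card_sha_two_primary_eq_card_invariants_sq
    W hK (isLiftOfAut_liftAut σ) hσ2 (baseChange_eq_of_a_eq_zero W K ha₁ ha₂ ha₃ ha₄) hζ hσζ
  rw [hcard]
  congr 1
  have hinj := JZero.shaRestriction_injective_of_isPrimitiveRoot W K ha₁ ha₂ ha₃ ha₄ h2 hζ hσζ
  -- the map `r : Ш(E/ℚ)[2^∞] → ker (s - id)` and its bijectivity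
  let r : AddCommGroup.primaryComponent W.sha 2 →+
      AddCommGroup.primaryComponent (W.baseChange K).sha 2 :=
    ((shaRestriction W K).comp (AddCommGroup.primaryComponent W.sha 2).subtype).codRestrict _
      fun c ↦ map_mem_primaryComponent (shaRestriction W K) c.2
  have hr : ∀ c, ((r c : AddCommGroup.primaryComponent (W.baseChange K).sha 2) :
      (W.baseChange K).sha) = shaRestriction W K c := fun _ ↦ rfl
  have hker : ∀ c, r c ∈ (s - AddMonoidHom.id _).ker := by
    intro c
    rw [AddMonoidHom.mem_ker, AddMonoidHom.sub_apply, AddMonoidHom.id_apply, sub_eq_zero]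
    apply Subtype.ext
    apply Subtype.ext
    rw [hs, hr, conjH1Points_shaRestriction]
  let r' : AddCommGroup.primaryComponent W.sha 2 →+ (s - AddMonoidHom.id _).ker :=
    r.codRestrict _ hker
  have hinj' : Function.Injective r' := fun c c' h ↦ by
    have h' : r c = r c' := congrArg Subtype.val h
    have h'' : shaRestriction W K c = shaRestriction W K c' := by
      rw [← hr, ← hr, h']
    exact Subtype.ext (hinj h'')
  have hsurj' : Function.Surjective r' := by
    rintro ⟨y, hy⟩
    -- `y ∈ M` is `τ_*`-invariant
    have hy' : s y = y := by
      rw [AddMonoidHom.mem_ker, AddMonoidHom.sub_apply, AddMonoidHom.id_apply, sub_eq_zero] at hy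
      exact hy
    have hinv : (isLiftOfAut_liftAut σ).conjH1Points W
        (((y : AddCommGroup.primaryComponent (W.baseChange K).sha 2) : (W.baseChange K).sha) :
          (W.baseChange K).galH1) = (y : (W.baseChange K).sha) := by
      rw [← hs, hy']
    obtain ⟨s₀, hs₀⟩ :=
      JZero.exists_shaRestriction_eq_of_conjH1Points_eq K W ha₁ ha₂ ha₃ ha₄ h2 hζ hσζ hinv
    -- `s₀` is `2`-primary since `res` is injective
    have hs₀mem : s₀ ∈ AddCommGroup.primaryComponent W.sha 2 := by
      obtain ⟨k, hk⟩ := AddCommGroup.mem_primaryComponent.mp y.2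
      refine AddCommGroup.mem_primaryComponent.mpr ⟨k, hinj ?_⟩
      rw [map_nsmul, hs₀, map_zero]
      exact hk
    exact ⟨⟨s₀, hs₀mem⟩, Subtype.ext (Subtype.ext hs₀)⟩
  exact (Nat.card_congr (Equiv.ofBijective r' ⟨hinj', hsurj'⟩)).symm

/-- **LEMMA K0, ORDER FORM, `ord₂` version**: `ord₂ #Ш(E_K/K)[2^∞] = 2 · ord₂ #Ш(E/ℚ)[2^∞]`
(`= 2 s_E`; with the junk value `padicValNat 2 0 = 0` on both sides when infinite). [cite: GrossLMS1991, §5 (5.1)]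
[cite: MilneADT2006, Ch. I §6 p. 75] -/
theorem padicValNat_card_primaryComponent_sha_baseChange (hK : ∀ v : InfinitePlace K, v.IsComplex)
    (hσ2 : σ * σ = 1) (ha₁ : W.a₁ = 0) (ha₂ : W.a₂ = 0) (ha₃ : W.a₃ = 0) (ha₄ : W.a₄ = 0)
    (h2 : Module.finrank ℚ K = 2) {ζ : K} (hζ : IsPrimitiveRoot ζ 3) (hσζ : σ ζ = ζ ^ 2) :
    padicValNat 2 (Nat.card (AddCommGroup.primaryComponent (W.baseChange K).sha 2)) =
      2 * padicValNat 2 (Nat.card (AddCommGroup.primaryComponent W.sha 2)) := by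
  rw [natCard_primaryComponent_sha_baseChange_eq_sq W K hK hσ2 ha₁ ha₂ ha₃ ha₄ h2 hζ hσζ]
  exact padicValNat.pow _ 2

/-- **LEMMA K0, ORDER FORM, in the currency of the VARIANT K stubs** (arbitrary `ℚ`-models): for
`X` with `C • X = ⟨0, 0, 0, 0, b⟩` (`= HuShuYin2019.cubeSumCurve p`, resp. `(3p²)`, by `rfl`),
`K`, `ζ`, `σ` as above: `#Ш(⟨0,0,0,0,b⟩_K/K)[2^∞] = (#Ш(X/ℚ)[2^∞])²` (MODEL TRANSPORT by
`natCard_primaryComponent_sha_eq_of_variableChange`). [cite: GrossLMS1991, §5 (5.1)]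
[cite: MilneADT2006, Ch. I Lemma 7.1(b), p. 96] -/
theorem natCard_primaryComponent_sha_baseChange_eq_sq_of_variableChange {X : WeierstrassCurve ℚ}
    [X.IsElliptic] {b : ℚ} {C : VariableChange ℚ} (hC : C • X = ⟨0, 0, 0, 0, b⟩)
    (hK : ∀ v : InfinitePlace K, v.IsComplex) (hσ2 : σ * σ = 1) (h2 : Module.finrank ℚ K = 2)
    {ζ : K} (hζ : IsPrimitiveRoot ζ 3) (hσζ : σ ζ = ζ ^ 2) :
    Nat.card (AddCommGroup.primaryComponent
        ((⟨0, 0, 0, 0, b⟩ : WeierstrassCurve ℚ).baseChange K).sha 2) =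
      Nat.card (AddCommGroup.primaryComponent X.sha 2) ^ 2 := by
  haveI : (⟨0, 0, 0, 0, b⟩ : WeierstrassCurve ℚ).IsElliptic := hC ▸ inferInstance
  rw [natCard_primaryComponent_sha_eq_of_variableChange hC 2]
  exact natCard_primaryComponent_sha_baseChange_eq_sq ⟨0, 0, 0, 0, b⟩ K hK hσ2 rfl rfl rfl rfl h2
    hζ hσζ

/-- **LEMMA K0, ORDER FORM — binder form** (the convention
`(K : Type) [NumberField K] (ω : K), ω² + ω + 1 = 0 → finrank ℚ K = 2` of
`HuShuYin2019.shaAnPair_mul_height_eq_two_zpow_mul_height` / `PublishedFactsTwoPlus`): for `X` with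
`C • X = ⟨0, 0, 0, 0, b⟩`: `#Ш(⟨0,0,0,0,b⟩_K/K)[2^∞] = (#Ш(X/ℚ)[2^∞])²`; `ζ`, `σ`, total
complexity discharged by `JZero.exists_aut_apply_eq_sq`. [cite: GrossLMS1991, §5 (5.1)]
[cite: MilneADT2006, Ch. I Lemma 7.1(b), p. 96] -/
theorem natCard_primaryComponent_sha_baseChange_eq_sq_of_omega {X : WeierstrassCurve ℚ}
    [X.IsElliptic] {b : ℚ} {C : VariableChange ℚ} (hC : C • X = ⟨0, 0, 0, 0, b⟩) {ω : K}
    (hω : ω ^ 2 + ω + 1 = 0) (h2 : Module.finrank ℚ K = 2) :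
    Nat.card (AddCommGroup.primaryComponent
        ((⟨0, 0, 0, 0, b⟩ : WeierstrassCurve ℚ).baseChange K).sha 2) =
      Nat.card (AddCommGroup.primaryComponent X.sha 2) ^ 2 := by
  obtain ⟨hζ, hK, σ, hσζ, hσ2⟩ := JZero.exists_aut_apply_eq_sq K hω h2
  exact natCard_primaryComponent_sha_baseChange_eq_sq_of_variableChange K hC hK hσ2 h2 hζ hσζ

/-- **`ord₂` binder form**: `ord₂ #Ш(⟨0,0,0,0,b⟩_K/K)[2^∞] = 2 · ord₂ #Ш(X/ℚ)[2^∞]` — the exact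
conversion between THEOREM K3's `𝒪₂`-length currency over `K = ℚ(ω)` and the `s_X` of the VARIANT K
stubs `stub_tailFour/Seven` (`padicValNat 2 (Nat.card (primaryComponent X.sha 2))`).
[cite: GrossLMS1991, §5 (5.1)] [cite: MilneADT2006, Ch. I Lemma 7.1(b), p. 96] -/
theorem padicValNat_card_primaryComponent_sha_baseChange_of_omega {X : WeierstrassCurve ℚ}
    [X.IsElliptic] {b : ℚ} {C : VariableChange ℚ} (hC : C • X = ⟨0, 0, 0, 0, b⟩) {ω : K}
    (hω : ω ^ 2 + ω + 1 = 0) (h2 : Module.finrank ℚ K = 2) :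
    padicValNat 2 (Nat.card (AddCommGroup.primaryComponent
        ((⟨0, 0, 0, 0, b⟩ : WeierstrassCurve ℚ).baseChange K).sha 2)) =
      2 * padicValNat 2 (Nat.card (AddCommGroup.primaryComponent X.sha 2)) := by
  rw [natCard_primaryComponent_sha_baseChange_eq_sq_of_omega K hC hω h2]
  exact padicValNat.pow _ 2

/-! ## LEMMA K0, STRUCTURE FORM: `Ш(E_K/K)[2^∞] ≅ Ш(E/ℚ)[2^∞] × Ш(E/ℚ)[2^∞]` -/

/-- **LEMMA K0, STRUCTURE FORM** (memo two §57.1 «`Ш(X/K)[2^∞] ≅ Ш(X/ℚ)[2^∞] ⊗_{ℤ₂} 𝒪₂`»): with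
`S = Ш(E/ℚ)[2^∞]`, `M = Ш(E_K/K)[2^∞]`, there are the restriction `r : S → M` (underlying map
`shaRestriction`) and the CM operator `w = [ω]` on `M` (`w² + w + 1 = 0`) such that
`S × S → M`, `(c, d) ↦ r c + w (r d)` is a BIJECTION (so `M ≅ S ⊗ ℤ[ω]` as groups, `#M = (#S)²`,
`M ≅ ⊕ (𝒪₂/2^{Nᵢ})²` when `S ≅ ⊕ (ℤ/2^{Nᵢ})²`). Ingredients: LEMMA D's descent bijection
`M^{s} × M^{s} → M` (`SylvesterTwoUnramifiedDescent.descent_bijective` on the data of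
`SylvesterTwoShaConjugation.exists_lemmaD_data`, `s = τ_*` for `τ = liftAut σ`) and the bijection
`r : S ⥲ M^{s}` (injective: `JZero.shaRestriction_injective_of_isPrimitiveRoot`; onto the invariants:
`JZero.exists_shaRestriction_eq_of_conjH1Points_eq`). [cite: GrossLMS1991, §5 (5.1)]
[cite: SilvermanAEC2009, Thm. III.10.1 and Cor. III.10.2] [cite: MilneADT2006, Ch. I §6 p. 75] -/
theorem exists_descent_bijective (hK : ∀ v : InfinitePlace K, v.IsComplex) (hσ2 : σ * σ = 1)
    (ha₁ : W.a₁ = 0) (ha₂ : W.a₂ = 0) (ha₃ : W.a₃ = 0) (ha₄ : W.a₄ = 0)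
    (h2 : Module.finrank ℚ K = 2) {ζ : K} (hζ : IsPrimitiveRoot ζ 3) (hσζ : σ ζ = ζ ^ 2) :
    ∃ (r : AddCommGroup.primaryComponent W.sha 2 →+
        AddCommGroup.primaryComponent (W.baseChange K).sha 2)
      (w : AddCommGroup.primaryComponent (W.baseChange K).sha 2 →+
        AddCommGroup.primaryComponent (W.baseChange K).sha 2),
      (∀ c, ((r c : AddCommGroup.primaryComponent (W.baseChange K).sha 2) :
        (W.baseChange K).sha) = shaRestriction W K c) ∧
      (∀ x, w (w x) + w x + x = 0) ∧
      Function.Bijective fun cd : AddCommGroup.primaryComponent W.sha 2 ×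
          AddCommGroup.primaryComponent W.sha 2 ↦ r cd.1 + w (r cd.2) := by
  obtain ⟨φ, w, s, -, hs, hw, hss, hsw, h3⟩ := SylvesterTwoShaConjugation.exists_lemmaD_data W hK
    (isLiftOfAut_liftAut σ) hσ2 (baseChange_eq_of_a_eq_zero W K ha₁ ha₂ ha₃ ha₄) hζ hσζ
  have hdesc := SylvesterTwoUnramifiedDescent.descent_bijective w s hw hss hsw h3
  have hinj := JZero.shaRestriction_injective_of_isPrimitiveRoot W K ha₁ ha₂ ha₃ ha₄ h2 hζ hσζ
  let r : AddCommGroup.primaryComponent W.sha 2 →+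
      AddCommGroup.primaryComponent (W.baseChange K).sha 2 :=
    ((shaRestriction W K).comp (AddCommGroup.primaryComponent W.sha 2).subtype).codRestrict _
      fun c ↦ map_mem_primaryComponent (shaRestriction W K) c.2
  have hr : ∀ c, ((r c : AddCommGroup.primaryComponent (W.baseChange K).sha 2) :
      (W.baseChange K).sha) = shaRestriction W K c := fun _ ↦ rfl
  have hker : ∀ c, r c ∈ (s - AddMonoidHom.id _).ker := by
    intro c
    rw [AddMonoidHom.mem_ker, AddMonoidHom.sub_apply, AddMonoidHom.id_apply, sub_eq_zero]
    apply Subtype.ext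
    apply Subtype.ext
    rw [hs, hr, conjH1Points_shaRestriction]
  let r' : AddCommGroup.primaryComponent W.sha 2 →+ (s - AddMonoidHom.id _).ker :=
    r.codRestrict _ hker
  have hbij' : Function.Bijective r' := by
    refine ⟨fun c c' h ↦ ?_, ?_⟩
    · have h' : r c = r c' := congrArg Subtype.val h
      have h'' : shaRestriction W K c = shaRestriction W K c' := by rw [← hr, ← hr, h']
      exact Subtype.ext (hinj h'')
    · rintro ⟨y, hy⟩
      have hy' : s y = y := by
        rw [AddMonoidHom.mem_ker, AddMonoidHom.sub_apply, AddMonoidHom.id_apply, sub_eq_zero] at hy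
        exact hy
      have hinv : (isLiftOfAut_liftAut σ).conjH1Points W
          (((y : AddCommGroup.primaryComponent (W.baseChange K).sha 2) : (W.baseChange K).sha) :
            (W.baseChange K).galH1) = (y : (W.baseChange K).sha) := by
        rw [← hs, hy']
      obtain ⟨s₀, hs₀⟩ :=
        JZero.exists_shaRestriction_eq_of_conjH1Points_eq K W ha₁ ha₂ ha₃ ha₄ h2 hζ hσζ hinv
      have hs₀mem : s₀ ∈ AddCommGroup.primaryComponent W.sha 2 := by
        obtain ⟨k, hk⟩ := AddCommGroup.mem_primaryComponent.mp y.2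
        refine AddCommGroup.mem_primaryComponent.mpr ⟨k, hinj ?_⟩
        rw [map_nsmul, hs₀, map_zero]
        exact hk
      exact ⟨⟨s₀, hs₀mem⟩, Subtype.ext (Subtype.ext hs₀)⟩
  refine ⟨r, w, hr, hw, ?_⟩
  -- `(c, d) ↦ r c + w (r d)` is `descent ∘ (r' × r')`
  have hcomp : (fun cd : AddCommGroup.primaryComponent W.sha 2 ×
      AddCommGroup.primaryComponent W.sha 2 ↦ r cd.1 + w (r cd.2)) =
      (fun st : (s - AddMonoidHom.id _).ker × (s - AddMonoidHom.id _).ker ↦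
        (st.1 : AddCommGroup.primaryComponent (W.baseChange K).sha 2) + w st.2) ∘
      (fun cd ↦ (r' cd.1, r' cd.2)) := rfl
  rw [hcomp]
  exact hdesc.comp ⟨fun a b h ↦ Prod.ext (hbij'.1 (Prod.mk.inj h).1) (hbij'.1 (Prod.mk.inj h).2),
    fun st ↦ ⟨((hbij'.2 st.1).choose, (hbij'.2 st.2).choose),
      Prod.ext (hbij'.2 st.1).choose_spec (hbij'.2 st.2).choose_spec⟩⟩

/-- **`Ш(E_K/K)[2^∞] ≃+ Ш(E/ℚ)[2^∞] × Ш(E/ℚ)[2^∞]`** (as abelian groups; from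
`exists_descent_bijective`). [cite: GrossLMS1991, §5 (5.1)] [cite: MilneADT2006, Ch. I §6 p. 75] -/
theorem nonempty_addEquiv_prod (hK : ∀ v : InfinitePlace K, v.IsComplex) (hσ2 : σ * σ = 1)
    (ha₁ : W.a₁ = 0) (ha₂ : W.a₂ = 0) (ha₃ : W.a₃ = 0) (ha₄ : W.a₄ = 0)
    (h2 : Module.finrank ℚ K = 2) {ζ : K} (hζ : IsPrimitiveRoot ζ 3) (hσζ : σ ζ = ζ ^ 2) :
    Nonempty (AddCommGroup.primaryComponent W.sha 2 × AddCommGroup.primaryComponent W.sha 2 ≃+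
      AddCommGroup.primaryComponent (W.baseChange K).sha 2) := by
  obtain ⟨r, w, -, -, hbij⟩ := exists_descent_bijective W K hK hσ2 ha₁ ha₂ ha₃ ha₄ h2 hζ hσζ
  let f : AddCommGroup.primaryComponent W.sha 2 × AddCommGroup.primaryComponent W.sha 2 →+
      AddCommGroup.primaryComponent (W.baseChange K).sha 2 :=
    (r.comp (AddMonoidHom.fst _ _)) + (w.comp (r.comp (AddMonoidHom.snd _ _)))
  have hf : (f : _ → _) = fun cd ↦ r cd.1 + w (r cd.2) := rfl
  exact ⟨AddEquiv.ofBijective f (hf ▸ hbij)⟩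

/-- **Structure form, binder version**: for `X` with `C • X = ⟨0, 0, 0, 0, b⟩`, `K ∋ ω` with
`ω² + ω + 1 = 0`, `finrank ℚ K = 2`: `Ш(⟨0,0,0,0,b⟩_K/K)[2^∞] ≃+ Ш(X/ℚ)[2^∞] × Ш(X/ℚ)[2^∞]`
(model transport through the variable change `Isogeny`, `VariableChange.toIsogeny`, which induces an
isomorphism of `Ш[2^∞]` — here only recorded as `Nat.card` equality; the group isomorphism on the short
model). [cite: GrossLMS1991, §5 (5.1)] [cite: MilneADT2006, Ch. I Lemma 7.1(b), p. 96] -/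
theorem nonempty_addEquiv_prod_of_omega {b : ℚ} [(⟨0, 0, 0, 0, b⟩ : WeierstrassCurve ℚ).IsElliptic]
    {ω : K} (hω : ω ^ 2 + ω + 1 = 0) (h2 : Module.finrank ℚ K = 2) :
    Nonempty (AddCommGroup.primaryComponent (⟨0, 0, 0, 0, b⟩ : WeierstrassCurve ℚ).sha 2 ×
        AddCommGroup.primaryComponent (⟨0, 0, 0, 0, b⟩ : WeierstrassCurve ℚ).sha 2 ≃+
      AddCommGroup.primaryComponent
        ((⟨0, 0, 0, 0, b⟩ : WeierstrassCurve ℚ).baseChange K).sha 2) := by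
  obtain ⟨hζ, hK, σ, hσζ, hσ2⟩ := JZero.exists_aut_apply_eq_sq K hω h2
  exact nonempty_addEquiv_prod ⟨0, 0, 0, 0, b⟩ K hK hσ2 rfl rfl rfl rfl h2 hζ hσζ

end Summit.BirchSwinnertonDyer.BirchSwinnertonDyer.Theorems.SylvesterTwoShaDescentOrderForm

end
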